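import Literature.NumberTheory.Sieve.SmoothMajorantDensity
import Mathlib.Analysis.SpecialFunctions.Pow.Complex
import Mathlib.Analysis.Complex.Basic
import Mathlib.NumberTheory.ArithmeticFunction.Moebius
import Mathlib.NumberTheory.EulerProduct.DirichletLSeries
import Mathlib.Data.Nat.Squarefree
import HarnessLib

/-!
# Local input for the smooth linear forms estimate (Conlon–Fox–Zhao §9): the Euler factor `E_p`

Trunk T-SIEVE. D. Conlon, J. Fox, Y. Zhao, *The Green–Tao theorem: an exposition*
(arXiv:1403.2957), §9, p. 17: the Euler factor
`E_p(ξ) = ∑_{d_j, d'_j ∈ {1,p}} E_{x ∈ ℤ_p^t}[1_{d_j,d'_j ∣ θ_j(x) ∀ j}] ∏_j μ(d_j) d_j^{-z_j} μ(d'_j) d'_j^{-z'_j}`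
and its comparison with the main term: "`E_p(ξ) = 1` when `p ≤ w` … for `p > w`,
`E_p(ξ) = 1 - p^{-1} ∑_j (p^{-z_j} + p^{-z'_j} - p^{-z_j-z'_j}) + O(p^{-2})`".

* `projPattern`, `sumExp`, `eulerFactor` (`E_p` as a sum over the `4^m` divisibility patterns
  `Y ⊆ [m] ⊔ [m]`, weighted by the local densities `ω_p(π Y)` of `SmoothMajorantCRT` /
  `SmoothMajorantDensity`),
  `eulerMain` (the displayed main term), `eulerFactor'` (`E'_p`);
* proved: `eulerFactor_eq_one_of_dvd` (`p ∣ W`), the single-index contribution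
  `sum_filter_projPattern_eq_singleton`, and `norm_eulerFactor_sub_main_le`
  (`|E_p - main| ≤ 4^m / p²` for `p ∤ W` and a system non-degenerate modulo `p`).

## References
* D. Conlon, J. Fox, Y. Zhao, EMS Surv. Math. Sci. 1 (2014), 249–282, §9 (p. 17, `E_p`).
  [cite: ConlonFoxZhao2014]
* B. Green, T. Tao, Ann. of Math. 167 (2008), (10.7)–(10.8) (the same computation).
  [cite: GreenTaoAnnals2008]
-/

noncomputable section

open Finset Complex
open scoped BigOperators

namespace Literature.NumberTheory.Sieve.CFZ

variable {m t : ℕ}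

/-! ### Definitions -/

/-- The set of indices `j` hit by a pattern `Y ⊆ [m] ⊔ [m]` (entries of `d` in the left copy, of
`d'` in the right copy): `π(Y) = {j : inl j ∈ Y ∨ inr j ∈ Y} = X_p ∪ X'_p`.
[cite: ConlonFoxZhao2014, Section 9] -/
def projPattern (Y : Finset (Fin m ⊕ Fin m)) : Finset (Fin m) :=
  univ.filter fun j => Sum.inl j ∈ Y ∨ Sum.inr j ∈ Y

/-- The exponents `(z, z')` as one function on `[m] ⊔ [m]`. [cite: ConlonFoxZhao2014, Section 9] -/
def sumExp (z z' : Fin m → ℂ) : Fin m ⊕ Fin m → ℂ := fun i => Sum.elim z z' i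

/-- **The Euler factor** `E_p(z, z') = ∑_{Y ⊆ [m] ⊔ [m]} ω_p(π Y) ∏_{i ∈ Y} (-p^{-w_i})`,
`w = (z, z')` (`d_j, d'_j ∈ {1,p}`, `μ(p) = -1`). [cite: ConlonFoxZhao2014, Section 9] -/
def eulerFactor (p W : ℕ) (L : Fin m → Fin t → ℤ) (b : Fin m → ℤ) (z z' : Fin m → ℂ) : ℂ :=
  ∑ Y : Finset (Fin m ⊕ Fin m), (localDensity₀ p W L b (projPattern Y) : ℂ) *
    ∏ i ∈ Y, -((p : ℂ) ^ (-(sumExp z z' i)))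

/-- The main term `1 - p^{-1} ∑_j (p^{-z_j} + p^{-z'_j} - p^{-z_j-z'_j})` of both `E_p` and `E'_p`.
[cite: ConlonFoxZhao2014, Section 9] -/
def eulerMain (p : ℕ) (z z' : Fin m → ℂ) : ℂ :=
  1 - (p : ℂ)⁻¹ * ∑ j, ((p : ℂ) ^ (-(z j)) + (p : ℂ) ^ (-(z' j)) - (p : ℂ) ^ (-(z j + z' j)))

/-- `E'_p(z, z') = ∏_j (1 - p^{-1-z_j})(1 - p^{-1-z'_j}) / (1 - p^{-1-z_j-z'_j})`.
[cite: ConlonFoxZhao2014, Section 9] -/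
def eulerFactor' (p : ℕ) (z z' : Fin m → ℂ) : ℂ :=
  ∏ j, (1 - (p : ℂ) ^ (-(1 + z j))) * (1 - (p : ℂ) ^ (-(1 + z' j))) / (1 - (p : ℂ) ^ (-(1 + z j + z' j)))

/-! ### Patterns -/

/-- `π(∅) = ∅`. [cite: ConlonFoxZhao2014, Section 9] -/
@[simp] theorem projPattern_empty : projPattern (∅ : Finset (Fin m ⊕ Fin m)) = ∅ := by
  simp [projPattern]

/-- A nonempty pattern hits some index. [cite: ConlonFoxZhao2014, Section 9] -/
theorem projPattern_nonempty {Y : Finset (Fin m ⊕ Fin m)} (hY : Y.Nonempty) : (projPattern Y).Nonempty := by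
  obtain ⟨i, hi⟩ := hY
  rcases i with j | j
  · exact ⟨j, by simp [projPattern, hi]⟩
  · exact ⟨j, by simp [projPattern, hi]⟩

/-- `π(Y) = ∅ ↔ Y = ∅`. [cite: ConlonFoxZhao2014, Section 9] -/
theorem projPattern_eq_empty_iff {Y : Finset (Fin m ⊕ Fin m)} : projPattern Y = ∅ ↔ Y = ∅ := by
  constructor
  · intro h
    by_contra hne
    exact (projPattern_nonempty (nonempty_iff_ne_empty.2 hne)).ne_empty h
  · rintro rfl; exact projPattern_empty

/-- The patterns hitting exactly the index `j` are `{inl j}`, `{inr j}`, `{inl j, inr j}`.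
[cite: ConlonFoxZhao2014, Section 9] -/
theorem filter_projPattern_eq_singleton (j : Fin m) :
    ((univ : Finset (Finset (Fin m ⊕ Fin m))).filter fun Y => projPattern Y = {j}) =
      {{Sum.inl j}, {Sum.inr j}, {Sum.inl j, Sum.inr j}} := by
  ext Y
  simp only [mem_filter, mem_univ, true_and, mem_insert, mem_singleton]
  constructor
  · intro h
    have hsub : Y ⊆ {Sum.inl j, Sum.inr j} := by
      intro i hi
      rcases i with j' | j'
      · have : j' ∈ projPattern Y := by simp [projPattern, hi]
        rw [h, mem_singleton] at this
        simp [this]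
      · have : j' ∈ projPattern Y := by simp [projPattern, hi]
        rw [h, mem_singleton] at this
        simp [this]
    have hne : Y ≠ ∅ := by
      rintro rfl
      rw [projPattern_empty] at h
      exact (singleton_ne_empty j) h.symm
    -- a nonempty subset of a two-element set
    have hcases : Y = {Sum.inl j} ∨ Y = {Sum.inr j} ∨ Y = {Sum.inl j, Sum.inr j} := by
      rw [Finset.subset_insert_iff] at hsub
      by_cases h1 : Sum.inl j ∈ Y
      · rcases Finset.subset_singleton_iff.1 hsub with h2 | h2
        · left
          rw [← insert_erase h1, h2]; rfl
        · right; right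
          rw [← insert_erase h1, h2]
      · rw [erase_eq_of_notMem h1] at hsub
        rcases Finset.subset_singleton_iff.1 hsub with h2 | h2
        · exact absurd h2 hne
        · right; left; exact h2
    exact hcases
  · intro h
    have hlr : Sum.inl j ≠ (Sum.inr j : Fin m ⊕ Fin m) := Sum.inl_ne_inr
    rcases h with rfl | rfl | rfl <;>
      · ext j'; simp [projPattern]

/-! ### `E_p` for `p ∣ W` -/

/-- **`E_p = 1` when `p ∣ W`** ("`E_p(ξ) = 1` when `p ≤ w`"): every nonempty pattern has weight
`ω_p(π Y) = 0`. [cite: ConlonFoxZhao2014, Section 9] -/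
theorem eulerFactor_eq_one_of_dvd {p W : ℕ} [Fact p.Prime] (hpW : p ∣ W) (L : Fin m → Fin t → ℤ)
    (b : Fin m → ℤ) (z z' : Fin m → ℂ) : eulerFactor p W L b z z' = 1 := by
  haveI : NeZero p := ⟨(Fact.out : p.Prime).ne_zero⟩
  unfold eulerFactor
  rw [Fintype.sum_eq_single ∅]
  · simp [localDensity₀_empty]
  · intro Y hY
    rw [localDensity₀_eq,
      localDensity_eq_zero_of_dvd hpW L b (projPattern_nonempty (nonempty_iff_ne_empty.2 hY))]
    simp

/-! ### The single-index contribution -/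

/-- The three patterns hitting exactly `j` contribute
`ω_p({j}) (-p^{-z_j} - p^{-z'_j} + p^{-z_j-z'_j})`. [cite: ConlonFoxZhao2014, Section 9] -/
theorem sum_filter_projPattern_eq_singleton {p W : ℕ} [NeZero p] (L : Fin m → Fin t → ℤ)
    (b : Fin m → ℤ) (z z' : Fin m → ℂ) (j : Fin m) :
    ∑ Y ∈ (univ : Finset (Finset (Fin m ⊕ Fin m))).filter (fun Y => projPattern Y = {j}),
        (localDensity₀ p W L b (projPattern Y) : ℂ) * ∏ i ∈ Y, -((p : ℂ) ^ (-(sumExp z z' i))) =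
      (localDensity₀ p W L b {j} : ℂ) *
        (-((p : ℂ) ^ (-(z j))) - (p : ℂ) ^ (-(z' j)) + (p : ℂ) ^ (-(z j + z' j))) := by
  have hp0 : (p : ℂ) ≠ 0 := by exact_mod_cast NeZero.ne p
  have hlr : Sum.inl j ≠ (Sum.inr j : Fin m ⊕ Fin m) := Sum.inl_ne_inr
  have hπ : ∀ Y ∈ (univ : Finset (Finset (Fin m ⊕ Fin m))).filter (fun Y => projPattern Y = {j}),
      (localDensity₀ p W L b (projPattern Y) : ℂ) * ∏ i ∈ Y, -((p : ℂ) ^ (-(sumExp z z' i))) =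
        (localDensity₀ p W L b {j} : ℂ) * ∏ i ∈ Y, -((p : ℂ) ^ (-(sumExp z z' i))) :=
    fun Y hY => by rw [(mem_filter.1 hY).2]
  rw [sum_congr rfl hπ, ← mul_sum, filter_projPattern_eq_singleton]
  congr 1
  have h1 : ({Sum.inl j} : Finset (Fin m ⊕ Fin m)) ∉ ({{Sum.inr j}, {Sum.inl j, Sum.inr j}} :
      Finset (Finset (Fin m ⊕ Fin m))) := by
    simp only [mem_insert, mem_singleton, not_or]
    constructor
    · intro h; have := congrArg (Sum.inl j ∈ ·) h; simp [hlr] at this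
    · intro h; have := congrArg (Sum.inr j ∈ ·) h; simp [hlr.symm] at this
  have h2 : ({Sum.inr j} : Finset (Fin m ⊕ Fin m)) ∉ ({{Sum.inl j, Sum.inr j}} :
      Finset (Finset (Fin m ⊕ Fin m))) := by
    simp only [mem_singleton]
    intro h; have := congrArg (Sum.inl j ∈ ·) h; simp [hlr] at this
  rw [sum_insert h1, sum_insert h2, sum_singleton, prod_singleton, prod_singleton, prod_pair hlr]
  simp only [sumExp, Sum.elim_inl, Sum.elim_inr]
  rw [neg_mul_neg, ← cpow_add _ _ hp0, neg_add]
  ring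

/-! ### `E_p` for `p ∤ W`: comparison with the main term -/

/-- The coefficients have modulus at most one: `|∏_{i ∈ Y} (-p^{-w_i})| ≤ 1` for `Re w ≥ 0`.
[cite: ConlonFoxZhao2014, Section 9] -/
theorem norm_prod_neg_cpow_le {p : ℕ} (hp : 0 < p) {z z' : Fin m → ℂ} (hz : ∀ j, 0 ≤ (z j).re)
    (hz' : ∀ j, 0 ≤ (z' j).re) (Y : Finset (Fin m ⊕ Fin m)) :
    ‖∏ i ∈ Y, -((p : ℂ) ^ (-(sumExp z z' i)))‖ ≤ 1 := by
  refine (Finset.norm_prod_le _ _).trans (prod_le_one (fun _ _ => norm_nonneg _) fun i _ => ?_)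
  rw [norm_neg, norm_natCast_cpow_of_pos hp]
  have hre : 0 ≤ (sumExp z z' i).re := by
    rcases i with j | j
    · exact hz j
    · exact hz' j
  have hp1 : (1 : ℝ) ≤ p := by exact_mod_cast hp
  simpa using Real.rpow_le_one_of_one_le_of_nonpos hp1 (by simpa using hre)

/-- **`E_p = 1 - p^{-1}∑_j(p^{-z_j} + p^{-z'_j} - p^{-z_j-z'_j}) + O(p^{-2})` for `p ∤ W`** (CFZ p. 17),
with the explicit constant `4^m`: the patterns with `|π Y| ≥ 2` have `ω_p(π Y) ≤ p^{-2}` (two rows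
with a minor nonzero modulo `p`) and coefficients of modulus `≤ 1`, and there are at most `4^m`
of them; the patterns with `|π Y| ≤ 1` give exactly the main term (`ω_p(∅) = 1`,
`ω_p({j}) = 1/p`). [cite: ConlonFoxZhao2014, Section 9] -/
theorem norm_eulerFactor_sub_main_le {p W n : ℕ} [Fact p.Prime] (hpW : ¬ p ∣ W)
    (L : Fin m → Fin (n + 1) → ℤ) (b : Fin m → ℤ)
    (hrow : ∀ i, ∃ j, (L i j : ZMod p) ≠ 0)
    (hmin : ∀ i i', i ≠ i' → ∃ j₀ j₁ : Fin (n + 1), j₀ ≠ j₁ ∧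
      ((L i j₀ * L i' j₁ - L i j₁ * L i' j₀ : ℤ) : ZMod p) ≠ 0)
    {z z' : Fin m → ℂ} (hz : ∀ j, 0 ≤ (z j).re) (hz' : ∀ j, 0 ≤ (z' j).re) :
    ‖eulerFactor p W L b z z' - eulerMain p z z'‖ ≤ 4 ^ m / (p : ℝ) ^ 2 := by
  classical
  have hp : p.Prime := Fact.out
  haveI : NeZero p := ⟨hp.ne_zero⟩
  have hp0 : (0 : ℝ) < p := by exact_mod_cast hp.pos
  set T : Finset (Fin m ⊕ Fin m) → ℂ := fun Y =>
    (localDensity₀ p W L b (projPattern Y) : ℂ) * ∏ i ∈ Y, -((p : ℂ) ^ (-(sumExp z z' i))) with hT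
  -- split the patterns according to `#π(Y) ≤ 1`
  have hsplit : eulerFactor p W L b z z' =
      ∑ Y ∈ (univ : Finset (Finset (Fin m ⊕ Fin m))).filter (fun Y => #(projPattern Y) ≤ 1), T Y +
        ∑ Y ∈ (univ : Finset (Finset (Fin m ⊕ Fin m))).filter (fun Y => ¬ #(projPattern Y) ≤ 1), T Y := by
    unfold eulerFactor
    rw [sum_filter_add_sum_filter_not]
  -- the small patterns give the main term
  have hsmall : ∑ Y ∈ (univ : Finset (Finset (Fin m ⊕ Fin m))).filter (fun Y => #(projPattern Y) ≤ 1), T Y =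
      eulerMain p z z' := by
    -- `#π Y ≤ 1` iff `Y = ∅` or `π Y = {j}` for some `j`
    have hset : (univ : Finset (Finset (Fin m ⊕ Fin m))).filter (fun Y => #(projPattern Y) ≤ 1) =
        insert ∅ ((univ : Finset (Fin m)).biUnion fun j =>
          (univ : Finset (Finset (Fin m ⊕ Fin m))).filter fun Y => projPattern Y = {j}) := by
      ext Y
      simp only [mem_filter, mem_univ, true_and, mem_insert, mem_biUnion]
      constructor
      · intro h
        rcases Nat.lt_or_ge (#(projPattern Y)) 1 with h0 | h1
        · left
          exact projPattern_eq_empty_iff.1 (card_eq_zero.1 (by omega))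
        · right
          obtain ⟨j, hj⟩ := card_eq_one.1 (le_antisymm h h1)
          exact ⟨j, hj⟩
      · rintro (rfl | ⟨j, hj⟩)
        · simp
        · rw [hj, card_singleton]
    have hnotin : (∅ : Finset (Fin m ⊕ Fin m)) ∉ (univ : Finset (Fin m)).biUnion fun j =>
        (univ : Finset (Finset (Fin m ⊕ Fin m))).filter fun Y => projPattern Y = {j} := by
      simp only [mem_biUnion, mem_univ, true_and, mem_filter, projPattern_empty, not_exists]
      intro j h
      exact (singleton_ne_empty j) h.symm
    have hdisj : ((univ : Finset (Fin m)) : Set (Fin m)).PairwiseDisjoint fun j =>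
        (univ : Finset (Finset (Fin m ⊕ Fin m))).filter fun Y => projPattern Y = {j} := by
      intro j _ j' _ hjj'
      simp only [Function.onFun, disjoint_left, mem_filter, mem_univ, true_and]
      intro Y hY hY'
      rw [hY] at hY'
      exact hjj' (singleton_injective hY')
    rw [hset, sum_insert hnotin, sum_biUnion hdisj]
    rw [sum_congr rfl fun j _ => sum_filter_projPattern_eq_singleton L b z z' j]
    -- `T ∅ = 1`, `ω_p({j}) = 1/p`
    have hT0 : T ∅ = 1 := by simp [hT, localDensity₀_empty]
    have hω : ∀ j, localDensity₀ p W L b {j} = 1 / p := by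
      intro j
      obtain ⟨j₀, hj₀⟩ := hrow j
      rw [localDensity₀_eq]
      exact localDensity_singleton hpW L b j hj₀
    simp only [hT0, hω]
    unfold eulerMain
    push_cast
    rw [mul_sum]
    have : ∀ j : Fin m, (1 / (p : ℂ)) * (-((p : ℂ) ^ (-(z j))) - (p : ℂ) ^ (-(z' j)) + (p : ℂ) ^ (-(z j + z' j))) =
        -((p : ℂ)⁻¹ * ((p : ℂ) ^ (-(z j)) + (p : ℂ) ^ (-(z' j)) - (p : ℂ) ^ (-(z j + z' j)))) := by
      intro j; ring
    simp_rw [this, sum_neg_distrib]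
    ring
  -- the large patterns are `O(4^m/p²)`
  have hlarge : ∀ Y ∈ (univ : Finset (Finset (Fin m ⊕ Fin m))).filter (fun Y => ¬ #(projPattern Y) ≤ 1),
      ‖T Y‖ ≤ 1 / (p : ℝ) ^ 2 := by
    intro Y hY
    have hcard : 1 < #(projPattern Y) := not_le.1 (mem_filter.1 hY).2
    obtain ⟨i, hi, i', hi', hii'⟩ := one_lt_card.1 hcard
    obtain ⟨j₀, j₁, hj, hM⟩ := hmin i i' hii'
    have hω := localDensity_le_of_minor hpW L b hi hi' hj hM
    rw [← localDensity₀_eq] at hω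
    have hω0 := (localDensity₀_nonneg_le_one p W L b (projPattern Y)).1
    simp only [hT, norm_mul, Complex.norm_real, Real.norm_eq_abs, abs_of_nonneg hω0]
    calc localDensity₀ p W L b (projPattern Y) * ‖∏ i ∈ Y, -((p : ℂ) ^ (-(sumExp z z' i)))‖
        ≤ 1 / (p : ℝ) ^ 2 * 1 :=
          mul_le_mul hω (norm_prod_neg_cpow_le hp.pos hz hz' Y) (norm_nonneg _) (by positivity)
      _ = 1 / (p : ℝ) ^ 2 := mul_one _
  rw [hsplit, hsmall, add_sub_cancel_left]
  calc ‖∑ Y ∈ (univ : Finset (Finset (Fin m ⊕ Fin m))).filter (fun Y => ¬ #(projPattern Y) ≤ 1), T Y‖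
      ≤ ∑ Y ∈ (univ : Finset (Finset (Fin m ⊕ Fin m))).filter (fun Y => ¬ #(projPattern Y) ≤ 1), ‖T Y‖ :=
        norm_sum_le _ _
    _ ≤ ∑ _Y ∈ (univ : Finset (Finset (Fin m ⊕ Fin m))).filter (fun Y => ¬ #(projPattern Y) ≤ 1),
          1 / (p : ℝ) ^ 2 := sum_le_sum hlarge
    _ = #((univ : Finset (Finset (Fin m ⊕ Fin m))).filter (fun Y => ¬ #(projPattern Y) ≤ 1)) * (1 / (p : ℝ) ^ 2) := by
        rw [sum_const, nsmul_eq_mul]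
    _ ≤ (4 : ℝ) ^ m * (1 / (p : ℝ) ^ 2) := by
        gcongr
        calc (#((univ : Finset (Finset (Fin m ⊕ Fin m))).filter (fun Y => ¬ #(projPattern Y) ≤ 1)) : ℝ)
            ≤ #(univ : Finset (Finset (Fin m ⊕ Fin m))) := by exact_mod_cast card_filter_le _ _
          _ = (4 : ℝ) ^ m := by
              rw [card_univ, Fintype.card_finset, Fintype.card_sum, Fintype.card_fin]
              push_cast
              rw [← two_mul, pow_mul]; norm_num
    _ = 4 ^ m / (p : ℝ) ^ 2 := by ring


/-! ### `E'_p`: comparison with the main term, lower bound -/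

namespace EulerPrime

/-- One factor: for `|c| ≤ 1/2`, `(1-a)(1-b)/(1-c) - (1 - a - b + c) = ab + c(c-u)/(1-c)` with
`u = a + b - ab`, whence the bound `|a||b| + 2|c|(|c| + |a| + |b| + |a||b|)`.
[cite: ConlonFoxZhao2014, Section 9] -/
theorem norm_factor_sub_le (a b c : ℂ) (hc : ‖c‖ ≤ 1 / 2) :
    ‖(1 - a) * (1 - b) / (1 - c) - (1 - a - b + c)‖ ≤
      ‖a‖ * ‖b‖ + 2 * ‖c‖ * (‖c‖ + (‖a‖ + ‖b‖ + ‖a‖ * ‖b‖)) := by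
  have h1c : (1 : ℝ) / 2 ≤ ‖1 - c‖ := by
    have := norm_sub_norm_le (1 : ℂ) c
    rw [norm_one] at this
    linarith
  have h1c0 : (1 - c) ≠ 0 := by
    intro h; rw [h, norm_zero] at h1c; linarith
  have hid : (1 - a) * (1 - b) / (1 - c) - (1 - a - b + c) =
      a * b + c * (c - (a + b - a * b)) / (1 - c) := by
    field_simp
    ring
  rw [hid]
  refine (norm_add_le _ _).trans ?_
  rw [norm_mul, norm_div, norm_mul]
  have hB : ‖c - (a + b - a * b)‖ ≤ ‖c‖ + (‖a‖ + ‖b‖ + ‖a‖ * ‖b‖) :=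
    calc ‖c - (a + b - a * b)‖ ≤ ‖c‖ + ‖a + b - a * b‖ := norm_sub_le _ _
      _ ≤ ‖c‖ + (‖a‖ + ‖b‖ + ‖a‖ * ‖b‖) := by
          gcongr
          calc ‖a + b - a * b‖ ≤ ‖a + b‖ + ‖a * b‖ := norm_sub_le _ _
            _ ≤ ‖a‖ + ‖b‖ + ‖a‖ * ‖b‖ := by rw [norm_mul]; gcongr; exact norm_add_le _ _
  have hB0 : 0 ≤ ‖c‖ + (‖a‖ + ‖b‖ + ‖a‖ * ‖b‖) := by positivity
  refine add_le_add le_rfl ?_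
  rw [div_le_iff₀ (by linarith)]
  calc ‖c‖ * ‖c - (a + b - a * b)‖ ≤ ‖c‖ * (‖c‖ + (‖a‖ + ‖b‖ + ‖a‖ * ‖b‖)) := by gcongr
    _ = 2 * ‖c‖ * (‖c‖ + (‖a‖ + ‖b‖ + ‖a‖ * ‖b‖)) * (1 / 2) := by ring
    _ ≤ 2 * ‖c‖ * (‖c‖ + (‖a‖ + ‖b‖ + ‖a‖ * ‖b‖)) * ‖1 - c‖ := by gcongr

/-- Product expansion to first order: `|∏_{j ∈ s}(1 + g_j) - 1 - ∑_{j ∈ s} g_j| ≤ (1+G)^{#s} - 1 - #s G`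
for `|g_j| ≤ G`. [cite: ConlonFoxZhao2014, Section 9] -/
theorem norm_prod_one_add_sub_le {ι : Type*} [DecidableEq ι] (s : Finset ι) (g : ι → ℂ) {G : ℝ}
    (hG : ∀ j ∈ s, ‖g j‖ ≤ G) :
    ‖∏ j ∈ s, (1 + g j) - 1 - ∑ j ∈ s, g j‖ ≤ (1 + G) ^ #s - 1 - #s * G := by
  induction s using Finset.induction_on with
  | empty => simp
  | insert a s ha ih =>
    have hG0 : 0 ≤ G := (norm_nonneg _).trans (hG a (mem_insert_self a s))
    have hGa : ‖g a‖ ≤ G := hG a (mem_insert_self a s)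
    have ih' := ih fun j hj => hG j (mem_insert_of_mem hj)
    have hS : ‖∑ j ∈ s, g j‖ ≤ #s * G :=
      (norm_sum_le _ _).trans ((sum_le_sum fun j hj => hG j (mem_insert_of_mem hj)).trans
        (by rw [sum_const, nsmul_eq_mul]))
    rw [prod_insert ha, sum_insert ha, card_insert_of_notMem ha]
    set P := ∏ j ∈ s, (1 + g j)
    set S := ∑ j ∈ s, g j
    have hid' : (1 + g a) * P - 1 - (g a + S) = g a * S + (1 + g a) * (P - 1 - S) := by ring
    rw [hid']
    have h1ga : ‖1 + g a‖ ≤ 1 + G := (norm_add_le _ _).trans (by rw [norm_one]; gcongr)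
    calc ‖g a * S + (1 + g a) * (P - 1 - S)‖ ≤ ‖g a‖ * ‖S‖ + ‖1 + g a‖ * ‖P - 1 - S‖ := by
          refine (norm_add_le _ _).trans ?_; rw [norm_mul, norm_mul]
      _ ≤ G * (#s * G) + (1 + G) * ((1 + G) ^ #s - 1 - #s * G) :=
          add_le_add (mul_le_mul hGa hS (norm_nonneg _) hG0)
            (mul_le_mul h1ga ih' (norm_nonneg _) (by linarith))
      _ = (1 + G) ^ (#s + 1) - 1 - (#s + 1 : ℕ) * G := by push_cast; ring

/-- Zeroth order: `|∏_{j ∈ s}(1 + g_j) - 1| ≤ (1+G)^{#s} - 1`. [cite: ConlonFoxZhao2014, Section 9] -/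
theorem norm_prod_one_add_sub_one_le {ι : Type*} [DecidableEq ι] (s : Finset ι) (g : ι → ℂ) {G : ℝ}
    (hG : ∀ j ∈ s, ‖g j‖ ≤ G) : ‖∏ j ∈ s, (1 + g j) - 1‖ ≤ (1 + G) ^ #s - 1 := by
  have h1 := norm_prod_one_add_sub_le s g hG
  have hS : ‖∑ j ∈ s, g j‖ ≤ #s * G :=
    (norm_sum_le _ _).trans ((sum_le_sum hG).trans (by rw [sum_const, nsmul_eq_mul]))
  calc ‖∏ j ∈ s, (1 + g j) - 1‖ = ‖(∏ j ∈ s, (1 + g j) - 1 - ∑ j ∈ s, g j) + ∑ j ∈ s, g j‖ := by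
        rw [sub_add_cancel]
    _ ≤ ‖∏ j ∈ s, (1 + g j) - 1 - ∑ j ∈ s, g j‖ + ‖∑ j ∈ s, g j‖ := norm_add_le _ _
    _ ≤ _ := by linarith

/-- `(1+x)^n - 1 - nx ≤ n² x² (1+x)^n` for `x ≥ 0`. [folklore] -/
theorem one_add_pow_sub_le (x : ℝ) (hx : 0 ≤ x) (n : ℕ) :
    (1 + x) ^ n - 1 - n * x ≤ (n : ℝ) ^ 2 * x ^ 2 * (1 + x) ^ n := by
  induction n with
  | zero => simp
  | succ n ih =>
    have h1 : (1 : ℝ) ≤ (1 + x) ^ (n + 1) := one_le_pow₀ (by linarith)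
    have h2 : 0 ≤ (n : ℝ) ^ 2 * x ^ 2 * (1 + x) ^ n := by positivity
    calc (1 + x) ^ (n + 1) - 1 - (n + 1 : ℕ) * x
        = (1 + x) * ((1 + x) ^ n - 1 - n * x) + n * x ^ 2 := by push_cast; ring
      _ ≤ (1 + x) * ((n : ℝ) ^ 2 * x ^ 2 * (1 + x) ^ n) + n * x ^ 2 * (1 + x) ^ (n + 1) :=
          add_le_add (mul_le_mul_of_nonneg_left ih (by linarith))
            (le_mul_of_one_le_right (by positivity) h1)
      _ = ((n : ℝ) ^ 2 + n) * x ^ 2 * (1 + x) ^ (n + 1) := by ring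
      _ ≤ ((n + 1 : ℕ) : ℝ) ^ 2 * x ^ 2 * (1 + x) ^ (n + 1) := by
          gcongr
          push_cast; nlinarith

/-- `|p^{-(1+z)}| ≤ 1/p` for `Re z ≥ 0`. [cite: ConlonFoxZhao2014, Section 9] -/
theorem norm_cpow_neg_one_add_le {p : ℕ} (hp : 0 < p) {z : ℂ} (hz : 0 ≤ z.re) :
    ‖(p : ℂ) ^ (-(1 + z))‖ ≤ 1 / p := by
  rw [norm_natCast_cpow_of_pos hp]
  have hp1 : (1 : ℝ) ≤ p := by exact_mod_cast hp
  calc (p : ℝ) ^ (-(1 + z)).re ≤ (p : ℝ) ^ (-1 : ℝ) := by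
        apply Real.rpow_le_rpow_of_exponent_le hp1
        simp only [neg_re, add_re, one_re]
        linarith
    _ = 1 / p := by rw [Real.rpow_neg_one, one_div]

end EulerPrime

open EulerPrime in
/-- **`E'_p = 1 - p^{-1}∑_j(p^{-z_j} + p^{-z'_j} - p^{-z_j-z'_j}) + O_m(p^{-2})`** (CFZ p. 17, "`E'_p` is
basically an approximation of `E_p(ξ)`"): explicit constant `49 m² (9/2)^m + 8 m`, for `p ≥ 2` and
`Re z_j, Re z'_j ≥ 0`. [cite: ConlonFoxZhao2014, Section 9] -/
theorem norm_eulerFactor'_sub_main_le {p : ℕ} (hp : 2 ≤ p) {z z' : Fin m → ℂ}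
    (hz : ∀ j, 0 ≤ (z j).re) (hz' : ∀ j, 0 ≤ (z' j).re) :
    ‖eulerFactor' p z z' - eulerMain p z z'‖ ≤ (49 * (m : ℝ) ^ 2 * (9 / 2) ^ m + 8 * m) / (p : ℝ) ^ 2 := by
  have hp0 : (0 : ℝ) < p := by exact_mod_cast (by omega : 0 < p)
  have hpC : (p : ℂ) ≠ 0 := by exact_mod_cast (by omega : p ≠ 0)
  have hpinv : (1 : ℝ) / p ≤ 1 / 2 := by
    rw [div_le_div_iff₀ hp0 (by norm_num), one_mul, one_mul]; exact_mod_cast hp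
  -- notation: a_j = p^{-1-z_j}, b_j = p^{-1-z'_j}, c_j = p^{-1-z_j-z'_j}, e_j = a_j + b_j - c_j
  set a : Fin m → ℂ := fun j => (p : ℂ) ^ (-(1 + z j)) with ha
  set b : Fin m → ℂ := fun j => (p : ℂ) ^ (-(1 + z' j)) with hb
  set c : Fin m → ℂ := fun j => (p : ℂ) ^ (-(1 + z j + z' j)) with hc
  have han : ∀ j, ‖a j‖ ≤ 1 / p := fun j => norm_cpow_neg_one_add_le (by omega) (hz j)
  have hbn : ∀ j, ‖b j‖ ≤ 1 / p := fun j => norm_cpow_neg_one_add_le (by omega) (hz' j)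
  have hcn : ∀ j, ‖c j‖ ≤ 1 / p := fun j => by
    have := norm_cpow_neg_one_add_le (p := p) (by omega) (z := z j + z' j)
      (by rw [add_re]; linarith [hz j, hz' j])
    simpa [hc, add_assoc] using this
  -- the main term is `1 - ∑ e_j`
  have key : ∀ w : ℂ, (p : ℂ) ^ (-(1 + w)) = (p : ℂ)⁻¹ * (p : ℂ) ^ (-w) := fun w => by
    rw [neg_add, cpow_add _ _ hpC, cpow_neg_one]
  have hmain : eulerMain p z z' = 1 - ∑ j, (a j + b j - c j) := by
    unfold eulerMain
    rw [mul_sum]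
    congr 1
    refine sum_congr rfl fun j _ => ?_
    simp only [ha, hb, hc, add_assoc, key]
    ring
  -- each factor is `1 + g_j`, `g_j = -e_j + r_j`, `|r_j| ≤ 8/p²`, `|g_j| ≤ 7/p`
  set g : Fin m → ℂ := fun j => (1 - a j) * (1 - b j) / (1 - c j) - 1 with hg
  have hfac : eulerFactor' p z z' = ∏ j, (1 + g j) := by
    unfold eulerFactor'
    exact Fintype.prod_congr _ _ fun j => by simp [hg, ha, hb, hc]
  have hr : ∀ j, ‖g j + (a j + b j - c j)‖ ≤ 8 / (p : ℝ) ^ 2 := by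
    intro j
    have h := norm_factor_sub_le (a j) (b j) (c j) ((hcn j).trans hpinv)
    have hid : (1 - a j) * (1 - b j) / (1 - c j) - (1 - a j - b j + c j) = g j + (a j + b j - c j) := by
      simp only [hg]; ring
    rw [hid] at h
    refine h.trans ?_
    calc ‖a j‖ * ‖b j‖ + 2 * ‖c j‖ * (‖c j‖ + (‖a j‖ + ‖b j‖ + ‖a j‖ * ‖b j‖))
        ≤ 1 / p * (1 / p) + 2 * (1 / p) * (1 / p + (1 / p + 1 / p + 1 / p * (1 / 2))) := by
          gcongr <;> first | exact han j | exact hbn j | exact hcn j | exact (hbn j).trans hpinv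
      _ = 8 / (p : ℝ) ^ 2 := by field_simp; ring
  have hG : ∀ j ∈ (univ : Finset (Fin m)), ‖g j‖ ≤ 7 / p := by
    intro j _
    have h8 : 8 / (p : ℝ) ^ 2 ≤ 4 / p := by
      rw [div_le_div_iff₀ (by positivity) hp0]
      have : (2 : ℝ) ≤ p := by exact_mod_cast hp
      nlinarith
    calc ‖g j‖ = ‖(g j + (a j + b j - c j)) - (a j + b j - c j)‖ := by rw [add_sub_cancel_right]
      _ ≤ ‖g j + (a j + b j - c j)‖ + ‖a j + b j - c j‖ := norm_sub_le _ _
      _ ≤ 8 / (p : ℝ) ^ 2 + (1 / p + 1 / p + 1 / p) := by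
          gcongr
          · exact hr j
          · calc ‖a j + b j - c j‖ ≤ ‖a j + b j‖ + ‖c j‖ := norm_sub_le _ _
              _ ≤ ‖a j‖ + ‖b j‖ + ‖c j‖ := by gcongr; exact norm_add_le _ _
              _ ≤ _ := by gcongr <;> first | exact han j | exact hbn j | exact hcn j
      _ ≤ 4 / p + 3 / p := by rw [show (1 : ℝ) / p + 1 / p + 1 / p = 3 / p by ring]; gcongr
      _ = 7 / p := by ring
  -- assemble
  have hexp := norm_prod_one_add_sub_le univ g hG
  rw [card_univ, Fintype.card_fin] at hexp
  have hsumr : ‖∑ j, (g j + (a j + b j - c j))‖ ≤ m * (8 / (p : ℝ) ^ 2) :=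
    (norm_sum_le _ _).trans ((sum_le_sum fun j _ => hr j).trans (by rw [sum_const, card_univ,
      Fintype.card_fin, nsmul_eq_mul]))
  have hid : eulerFactor' p z z' - eulerMain p z z' =
      (∏ j, (1 + g j) - 1 - ∑ j, g j) + ∑ j, (g j + (a j + b j - c j)) := by
    rw [hfac, hmain, sum_add_distrib]; ring
  rw [hid]
  have hx0 : (0 : ℝ) ≤ 7 / p := by positivity
  have hx1 : (7 : ℝ) / p ≤ 7 / 2 := by
    rw [div_le_div_iff₀ hp0 (by norm_num)]; have : (2:ℝ) ≤ p := by exact_mod_cast hp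
    nlinarith
  calc ‖(∏ j, (1 + g j) - 1 - ∑ j, g j) + ∑ j, (g j + (a j + b j - c j))‖
      ≤ ((1 + 7 / p) ^ m - 1 - m * (7 / p)) + m * (8 / (p : ℝ) ^ 2) :=
        (norm_add_le _ _).trans (add_le_add hexp hsumr)
    _ ≤ (m : ℝ) ^ 2 * (7 / p) ^ 2 * (1 + 7 / p) ^ m + m * (8 / (p : ℝ) ^ 2) := by
        gcongr; exact one_add_pow_sub_le _ hx0 m
    _ ≤ (m : ℝ) ^ 2 * (7 / p) ^ 2 * (9 / 2) ^ m + m * (8 / (p : ℝ) ^ 2) := by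
        gcongr; linarith
    _ = (49 * (m : ℝ) ^ 2 * (9 / 2) ^ m + 8 * m) / (p : ℝ) ^ 2 := by
        field_simp; ring

open EulerPrime in
/-- **`E'_p` is bounded away from zero**: `|E'_p| ≥ 1/2` for `p ≥ 21 m + 2` and `Re z_j, Re z'_j ≥ 0`
(each factor is `1 + O(7/p)`). [cite: ConlonFoxZhao2014, Section 9] -/
theorem norm_eulerFactor'_ge {p : ℕ} (hp : 21 * m + 2 ≤ p) {z z' : Fin m → ℂ}
    (hz : ∀ j, 0 ≤ (z j).re) (hz' : ∀ j, 0 ≤ (z' j).re) : (1 : ℝ) / 2 ≤ ‖eulerFactor' p z z'‖ := by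
  have hp2 : 2 ≤ p := by omega
  have hp0 : (0 : ℝ) < p := by exact_mod_cast (by omega : 0 < p)
  -- reuse the factor analysis of the previous proof through its statement at order zero
  have hpC : (p : ℂ) ≠ 0 := by exact_mod_cast (by omega : p ≠ 0)
  have hpinv : (1 : ℝ) / p ≤ 1 / 2 := by
    rw [div_le_div_iff₀ hp0 (by norm_num), one_mul, one_mul]; exact_mod_cast hp2
  set a : Fin m → ℂ := fun j => (p : ℂ) ^ (-(1 + z j)) with ha
  set b : Fin m → ℂ := fun j => (p : ℂ) ^ (-(1 + z' j)) with hb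
  set c : Fin m → ℂ := fun j => (p : ℂ) ^ (-(1 + z j + z' j)) with hc
  have han : ∀ j, ‖a j‖ ≤ 1 / p := fun j => norm_cpow_neg_one_add_le (by omega) (hz j)
  have hbn : ∀ j, ‖b j‖ ≤ 1 / p := fun j => norm_cpow_neg_one_add_le (by omega) (hz' j)
  have hcn : ∀ j, ‖c j‖ ≤ 1 / p := fun j => by
    have := norm_cpow_neg_one_add_le (p := p) (by omega) (z := z j + z' j)
      (by rw [add_re]; linarith [hz j, hz' j])
    simpa [hc, add_assoc] using this
  set g : Fin m → ℂ := fun j => (1 - a j) * (1 - b j) / (1 - c j) - 1 with hg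
  have hfac : eulerFactor' p z z' = ∏ j, (1 + g j) := by
    unfold eulerFactor'
    exact Fintype.prod_congr _ _ fun j => by simp [hg, ha, hb, hc]
  have hG : ∀ j ∈ (univ : Finset (Fin m)), ‖g j‖ ≤ 7 / p := by
    intro j _
    have h := norm_factor_sub_le (a j) (b j) (c j) ((hcn j).trans hpinv)
    have hid : (1 - a j) * (1 - b j) / (1 - c j) - (1 - a j - b j + c j) = g j + (a j + b j - c j) := by
      simp only [hg]; ring
    rw [hid] at h
    have h1 : ‖a j‖ * ‖b j‖ ≤ 1 / p * (1 / 2) :=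
      mul_le_mul (han j) ((hbn j).trans hpinv) (norm_nonneg _) (by positivity)
    have hr : ‖g j + (a j + b j - c j)‖ ≤ 4 / p := by
      refine h.trans ?_
      calc ‖a j‖ * ‖b j‖ + 2 * ‖c j‖ * (‖c j‖ + (‖a j‖ + ‖b j‖ + ‖a j‖ * ‖b j‖))
          ≤ 1 / p * (1 / 2) + 2 * (1 / p) * (1 / 2 + (1 / 2 + 1 / 2 + 1 / p * (1 / 2))) := by
            gcongr <;> first | exact han j | exact hcn j | exact (hcn j).trans hpinv |
              exact (han j).trans hpinv | exact (hbn j).trans hpinv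
        _ = 3.5 / p + 1 / p * (1 / p) := by ring
        _ ≤ 3.5 / p + 1 / p * (1 / 2) := by gcongr
        _ = 4 / p := by ring
    calc ‖g j‖ = ‖(g j + (a j + b j - c j)) - (a j + b j - c j)‖ := by rw [add_sub_cancel_right]
      _ ≤ ‖g j + (a j + b j - c j)‖ + ‖a j + b j - c j‖ := norm_sub_le _ _
      _ ≤ 4 / p + (1 / p + 1 / p + 1 / p) := by
          gcongr
          calc ‖a j + b j - c j‖ ≤ ‖a j + b j‖ + ‖c j‖ := norm_sub_le _ _
            _ ≤ ‖a j‖ + ‖b j‖ + ‖c j‖ := by gcongr; exact norm_add_le _ _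
            _ ≤ _ := by gcongr <;> first | exact han j | exact hbn j | exact hcn j
      _ = 7 / p := by ring
  have h1 := norm_prod_one_add_sub_one_le univ g hG
  rw [card_univ, Fintype.card_fin] at h1
  -- `(1 + 7/p)^m ≤ exp(7m/p) ≤ 1/(1 - 7m/p) ≤ 3/2` since `7m/p ≤ 1/3`
  have hx0 : (0 : ℝ) ≤ 7 / p := by positivity
  have hmx : (m : ℝ) * (7 / p) ≤ 1 / 3 := by
    rw [mul_div_assoc', div_le_div_iff₀ hp0 (by norm_num)]
    have : (21 * m + 2 : ℝ) ≤ p := by exact_mod_cast hp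
    nlinarith
  have hpow : (1 + 7 / (p : ℝ)) ^ m ≤ 3 / 2 := by
    calc (1 + 7 / (p : ℝ)) ^ m ≤ Real.exp (7 / p) ^ m := by
          gcongr; linarith [Real.add_one_le_exp (7 / (p : ℝ))]
      _ = Real.exp (m * (7 / p)) := by rw [← Real.exp_nat_mul]
      _ ≤ Real.exp (1 / 3) := Real.exp_le_exp.2 hmx
      _ ≤ 3 / 2 := by
          -- `exp(1/3) ≤ 1/(1 - 1/3)` since `1 - y ≤ exp(-y)`
          have h' : Real.exp (1 / 3 : ℝ) ≤ 1 / (1 - 1 / 3) := by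
            have := Real.one_sub_le_exp_neg (1 / 3 : ℝ)
            rw [le_div_iff₀ (by norm_num)]
            calc Real.exp (1 / 3) * (1 - 1 / 3) ≤ Real.exp (1 / 3) * Real.exp (-(1 / 3)) := by
                  gcongr
              _ = 1 := by rw [← Real.exp_add]; simp
          linarith
  calc (1 : ℝ) / 2 ≤ 1 - ((1 + 7 / (p : ℝ)) ^ m - 1) := by linarith
    _ ≤ ‖(1 : ℂ)‖ - ‖∏ j, (1 + g j) - 1‖ := by rw [norm_one]; linarith
    _ ≤ ‖∏ j, (1 + g j)‖ := by
        have := norm_sub_norm_le (1 : ℂ) (1 - ∏ j, (1 + g j))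
        rw [sub_sub_cancel, norm_sub_rev] at this
        linarith
    _ = ‖eulerFactor' p z z'‖ := by rw [hfac]


/-! ### The multiplicative sum over tuples and its Euler product (CFZ (32) → (33)) -/

/-- `(∏_{p ∈ s} p)^w = ∏_{p ∈ s} p^w` for natural bases. [folklore] -/
theorem natCast_prod_cpow (s : Finset ℕ) (w : ℂ) :
    (((∏ p ∈ s, p : ℕ) : ℂ)) ^ w = ∏ p ∈ s, (p : ℂ) ^ w := by
  classical
  induction s using Finset.induction_on with
  | empty => simp
  | insert a s ha ih =>
    rw [prod_insert ha, prod_insert ha, Nat.cast_mul, natCast_mul_natCast_cpow, ih]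

/-- For square-free `n`: `#primeFactors(n) = Ω(n)`. [folklore] -/
theorem card_primeFactors_eq_cardFactors {n : ℕ} (hn : Squarefree n) :
    #n.primeFactors = ArithmeticFunction.cardFactors n := by
  rw [ArithmeticFunction.cardFactors_apply, Nat.primeFactors,
    List.toFinset_card_of_nodup ((Nat.squarefree_iff_nodup_primeFactorsList hn.ne_zero).1 hn)]

/-- For square-free `n`: `μ(n) n^{-w} = ∏_{p ∣ n} (-p^{-w})`. [cite: ConlonFoxZhao2014, Section 9] -/
theorem moebius_mul_cpow_eq_prod {n : ℕ} (hn : Squarefree n) (w : ℂ) :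
    (ArithmeticFunction.moebius n : ℂ) * (n : ℂ) ^ (-w) = ∏ p ∈ n.primeFactors, -((p : ℂ) ^ (-w)) := by
  rw [prod_neg, ← natCast_prod_cpow, Nat.prod_primeFactors_of_squarefree hn,
    ArithmeticFunction.moebius_apply_of_squarefree hn, ← card_primeFactors_eq_cardFactors hn]
  push_cast
  ring

/-- The truncated multiplicative sum over pairs of tuples of square-free numbers with prime factors
in `P`: `∑_{d, d'} E_{ℤ_D^t}[1_{d_j,d'_j ∣ θ_j ∀ j}] ∏_j μ(d_j) d_j^{-z_j} μ(d'_j) d'_j^{-z'_j}` (the inner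
sum of CFZ (33), truncated). [cite: ConlonFoxZhao2014, Section 9] -/
def tupleSum (P : Finset ℕ) (W : ℕ) (L : Fin m → Fin t → ℤ) (b : Fin m → ℤ) (z z' : Fin m → ℂ) : ℂ :=
  ∑ dd ∈ Fintype.piFinset (fun _ : Fin m ⊕ Fin m => squarefreeOf P),
    (tupleDensity W L b (fun j => dd (Sum.inl j)) (fun j => dd (Sum.inr j)) : ℂ) *
      ∏ i, ((ArithmeticFunction.moebius (dd i) : ℂ) * (dd i : ℂ) ^ (-(sumExp z z' i)))

/-- `π(pattern(dd, p)) = X_p ∪ X'_p`. [cite: ConlonFoxZhao2014, Section 9] -/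
theorem projPattern_pattern (dd : Fin m ⊕ Fin m → ℕ) (p : ℕ) :
    projPattern (pattern dd p) = pattern (fun j => dd (Sum.inl j)) p ∪ pattern (fun j => dd (Sum.inr j)) p := by
  ext j
  simp [projPattern, pattern]

/-- **CFZ (32) → (33), truncated: `∑_{d,d'} E_{ℤ_D^t}[⋯] ∏ μ d^{-z} μ d'^{-z'} = ∏_{p ∈ P} E_p`**
("Splitting `d_1, d'_1, …, d_m, d'_m` into prime factors"), for every finite set of primes `P`
(Chinese remainder factorisation of the weights and the finite Euler product over square-free
tuples). [cite: ConlonFoxZhao2014, Section 9] -/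
theorem tupleSum_eq_prod_eulerFactor {P : Finset ℕ} (hP : ∀ p ∈ P, p.Prime) (W : ℕ)
    (L : Fin m → Fin t → ℤ) (b : Fin m → ℤ) (z z' : Fin m → ℂ) :
    tupleSum P W L b z z' = ∏ p ∈ P, eulerFactor p W L b z z' := by
  classical
  -- the local factor attached to a prime and a pattern
  set f : P → Finset (Fin m ⊕ Fin m) → ℂ := fun p Y =>
    (localDensity₀ p W L b (projPattern Y) : ℂ) * ∏ i ∈ Y, -(((p : ℕ) : ℂ) ^ (-(sumExp z z' i))) with hf
  have hrhs : ∏ p ∈ P, eulerFactor p W L b z z' = ∏ p : P, ∑ Y : Finset (Fin m ⊕ Fin m), f p Y := by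
    rw [← prod_coe_sort P]
    rfl
  rw [hrhs, ← sum_squarefreeTuples_eq_prod hP f]
  refine sum_congr rfl fun dd hdd => ?_
  rw [Fintype.mem_piFinset] at hdd
  have hsq : ∀ i, Squarefree (dd i) ∧ (dd i).primeFactors ⊆ P := fun i => (mem_squarefreeOf hP).1 (hdd i)
  -- the weight
  rw [tupleDensity_eq_prod_localDensity W L b hP (fun j => hdd _) (fun j => hdd _)]
  -- the coefficients: `∏_i μ(dd_i) dd_i^{-w_i} = ∏_{p ∈ P} ∏_{i ∈ pattern dd p} (-p^{-w_i})`
  have hcoef : ∏ i, ((ArithmeticFunction.moebius (dd i) : ℂ) * (dd i : ℂ) ^ (-(sumExp z z' i))) =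
      ∏ p ∈ P, ∏ i ∈ pattern dd p, -((p : ℂ) ^ (-(sumExp z z' i))) := by
    rw [Fintype.prod_congr _ _ fun i => moebius_mul_cpow_eq_prod (hsq i).1 (sumExp z z' i)]
    rw [Finset.prod_comm' (s := univ) (t := fun i => (dd i).primeFactors) (t' := P)
      (s' := fun p => pattern dd p)]
    · intro i p
      simp only [mem_univ, true_and, pattern, mem_filter]
      constructor
      · intro hp
        exact ⟨Nat.dvd_of_mem_primeFactors hp, (hsq i).2 hp⟩
      · rintro ⟨hpd, hpP⟩
        exact Nat.mem_primeFactors.2 ⟨hP p hpP, hpd, (hsq i).1.ne_zero⟩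
  rw [hcoef, Complex.ofReal_prod, ← prod_mul_distrib, ← prod_coe_sort P]
  refine Fintype.prod_congr _ _ fun p => ?_
  simp only [hf, projPattern_pattern]


/-! ### The Euler product of `E'_p` (CFZ (35) reversed) -/

section ZetaProduct

open Filter Topology

/-- The finite Euler products of `ζ`, inverted: `∏_{p < n} (1 - p^{-s}) → 1/ζ(s)` for `Re s > 1`
(`riemannZeta_eulerProduct`). [cite: ConlonFoxZhao2014, Section 9, equation (35)] -/
theorem tendsto_prod_one_sub_cpow {s : ℂ} (hs : 1 < s.re) :
    Tendsto (fun n : ℕ => ∏ p ∈ n.primesBelow, (1 - (p : ℂ) ^ (-s))) atTop (𝓝 (riemannZeta s)⁻¹) := by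
  have h := (riemannZeta_eulerProduct hs).inv₀ (riemannZeta_ne_zero_of_one_lt_re hs)
  refine h.congr fun n => ?_
  rw [← Finset.prod_inv_distrib]
  exact Finset.prod_congr rfl fun p _ => inv_inv _

/-- **`∏_p E'_p = ∏_j ζ(1+z_j+z'_j)/(ζ(1+z_j) ζ(1+z'_j))`** (CFZ (35): "`∏_p (1 - p^{-1-z})^{-1} = ζ(1+z)`"),
as the limit of the finite products over `p < n`, for `Re z_j, Re z'_j > 0`.
[cite: ConlonFoxZhao2014, Section 9, equation (35)] -/
theorem tendsto_prod_eulerFactor' {z z' : Fin m → ℂ} (hz : ∀ j, 0 < (z j).re) (hz' : ∀ j, 0 < (z' j).re) :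
    Tendsto (fun n : ℕ => ∏ p ∈ n.primesBelow, eulerFactor' p z z') atTop
      (𝓝 (∏ j, riemannZeta (1 + z j + z' j) / (riemannZeta (1 + z j) * riemannZeta (1 + z' j)))) := by
  have h1 : ∀ j, 1 < (1 + z j).re := fun j => by simp; exact hz j
  have h2 : ∀ j, 1 < (1 + z' j).re := fun j => by simp; exact hz' j
  have h3 : ∀ j, 1 < (1 + z j + z' j).re := fun j => by simp; linarith [hz j, hz' j]
  -- rewrite the finite products prime-by-prime as products over `j`
  have hswap : ∀ n : ℕ, ∏ p ∈ n.primesBelow, eulerFactor' p z z' =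
      ∏ j, (∏ p ∈ n.primesBelow, (1 - (p : ℂ) ^ (-(1 + z j)))) *
        (∏ p ∈ n.primesBelow, (1 - (p : ℂ) ^ (-(1 + z' j)))) /
        ∏ p ∈ n.primesBelow, (1 - (p : ℂ) ^ (-(1 + z j + z' j))) := by
    intro n
    unfold eulerFactor'
    rw [Finset.prod_comm]
    refine Fintype.prod_congr _ _ fun j => ?_
    rw [Finset.prod_div_distrib, Finset.prod_mul_distrib]
  simp_rw [hswap]
  refine tendsto_finsetProd _ fun j _ => ?_
  have hlim := ((tendsto_prod_one_sub_cpow (h1 j)).mul (tendsto_prod_one_sub_cpow (h2 j))).div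
    (tendsto_prod_one_sub_cpow (h3 j)) (inv_ne_zero (riemannZeta_ne_zero_of_one_lt_re (h3 j)))
  refine (hlim.congr fun n => rfl).trans ?_
  rw [show (riemannZeta (1 + z j))⁻¹ * (riemannZeta (1 + z' j))⁻¹ / (riemannZeta (1 + z j + z' j))⁻¹ =
    riemannZeta (1 + z j + z' j) / (riemannZeta (1 + z j) * riemannZeta (1 + z' j)) by
      field_simp]

end ZetaProduct


/-! ### Small primes: `∏_{p ≤ w} E'_p ≈ (φ(W)/W)^m` (CFZ (36)) -/

section SmallPrimes

open EulerPrime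

/-- `|p^{-(1+w)} - 1/p| ≤ (2/p) |w| log p` when `|w| log p ≤ 1` ("`|z| log p = O(1/√log R)`").
[cite: ConlonFoxZhao2014, Section 9, Error estimates, Estimate in (36)] -/
theorem norm_cpow_neg_one_add_sub_inv_le {p : ℕ} (hp : 2 ≤ p) {w : ℂ} (hw : ‖w‖ * Real.log p ≤ 1) :
    ‖(p : ℂ) ^ (-(1 + w)) - (p : ℂ)⁻¹‖ ≤ 2 / p * (‖w‖ * Real.log p) := by
  have hp0 : (p : ℂ) ≠ 0 := by exact_mod_cast (by omega : p ≠ 0)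
  have hpr : (0 : ℝ) < p := by exact_mod_cast (by omega : 0 < p)
  have hlog : 0 ≤ Real.log p := Real.log_nonneg (by exact_mod_cast (by omega : 1 ≤ p))
  rw [neg_add, cpow_add _ _ hp0, cpow_neg_one, ← mul_sub_one, norm_mul, norm_inv,
    Complex.norm_natCast]
  have hexp : (p : ℂ) ^ (-w) = Complex.exp (-(w * Real.log p)) := by
    rw [cpow_def_of_ne_zero hp0, ← Complex.natCast_log]; ring_nf
  rw [hexp]
  have hn : ‖-(w * (Real.log p : ℂ))‖ = ‖w‖ * Real.log p := by
    rw [norm_neg, norm_mul, Complex.norm_real, Real.norm_eq_abs, abs_of_nonneg hlog]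
  have h1 : ‖Complex.exp (-(w * Real.log p)) - 1‖ ≤ 2 * (‖w‖ * Real.log p) :=
    calc ‖Complex.exp (-(w * Real.log p)) - 1‖ ≤ 2 * ‖-(w * (Real.log p : ℂ))‖ :=
          Complex.norm_exp_sub_one_le (by rw [hn]; exact hw)
      _ = 2 * (‖w‖ * Real.log p) := by rw [hn]
  calc (p : ℝ)⁻¹ * ‖Complex.exp (-(w * Real.log p)) - 1‖ ≤ (p : ℝ)⁻¹ * (2 * (‖w‖ * Real.log p)) := by
        gcongr
    _ = 2 / p * (‖w‖ * Real.log p) := by ring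

/-- One factor against `1 - 1/p`: with `q = 1/p`, `a = q + α`, `b = q + β`, `c = q + γ`,
`(1-a)(1-b)/(1-c) - (1-q) = ((1-q)(γ-α-β) + αβ)/(1-c)`, whence
`|(1-a)(1-b)/(1-c) - (1-q)| ≤ 4(2(|α| + |β| + |γ|) + |α||β|)` if `|c| ≤ 3/4`, `|q| ≤ 1`.
[cite: ConlonFoxZhao2014, Section 9, Error estimates, Estimate in (36)] -/
theorem norm_factor_sub_one_sub_le (q a b c : ℂ) (hc : ‖c‖ ≤ 3 / 4) (hq : ‖q‖ ≤ 1) :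
    ‖(1 - a) * (1 - b) / (1 - c) - (1 - q)‖ ≤
      4 * (2 * (‖a - q‖ + ‖b - q‖ + ‖c - q‖) + ‖a - q‖ * ‖b - q‖) := by
  have h1c : (1 : ℝ) / 4 ≤ ‖1 - c‖ := by
    have := norm_sub_norm_le (1 : ℂ) c; rw [norm_one] at this; linarith
  have h1c0 : (1 - c) ≠ 0 := fun h => by rw [h, norm_zero] at h1c; linarith
  have hid : (1 - a) * (1 - b) / (1 - c) - (1 - q) =
      ((1 - q) * ((c - q) - (a - q) - (b - q)) + (a - q) * (b - q)) / (1 - c) := by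
    field_simp; ring
  rw [hid, norm_div, div_le_iff₀ (by linarith)]
  have h1q : ‖1 - q‖ ≤ 2 := (norm_sub_le _ _).trans (by rw [norm_one]; linarith)
  calc ‖(1 - q) * ((c - q) - (a - q) - (b - q)) + (a - q) * (b - q)‖
      ≤ ‖1 - q‖ * ‖(c - q) - (a - q) - (b - q)‖ + ‖a - q‖ * ‖b - q‖ := by
        refine (norm_add_le _ _).trans ?_; rw [norm_mul, norm_mul]
    _ ≤ 2 * (‖c - q‖ + ‖a - q‖ + ‖b - q‖) + ‖a - q‖ * ‖b - q‖ := by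
        gcongr
        calc ‖(c - q) - (a - q) - (b - q)‖ ≤ ‖(c - q) - (a - q)‖ + ‖b - q‖ := norm_sub_le _ _
          _ ≤ ‖c - q‖ + ‖a - q‖ + ‖b - q‖ := by gcongr; exact norm_sub_le _ _
    _ = 4 * (2 * (‖a - q‖ + ‖b - q‖ + ‖c - q‖) + ‖a - q‖ * ‖b - q‖) * (1 / 4) := by ring
    _ ≤ 4 * (2 * (‖a - q‖ + ‖b - q‖ + ‖c - q‖) + ‖a - q‖ * ‖b - q‖) * ‖1 - c‖ := by gcongr

/-- **`E'_p = (1 - 1/p)^m (1 + O(δ log p / p))`-type bound for a single small prime**: for `p ≥ 2`,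
`|z_j|, |z'_j| ≤ δ`, `Re ≥ 0` and `2 δ log p ≤ 1/8`:
`|E'_p - (1-1/p)^m| ≤ ((1 + 144 δ log p/p)^m - 1) (1 - 1/p)^m`.
[cite: ConlonFoxZhao2014, Section 9, Error estimates, Estimate in (36)] -/
theorem norm_eulerFactor'_sub_pow_le {p : ℕ} (hp : 2 ≤ p) {z z' : Fin m → ℂ} {δ : ℝ}
    (hz : ∀ j, ‖z j‖ ≤ δ) (hz' : ∀ j, ‖z' j‖ ≤ δ) (hδ : 2 * δ * Real.log p ≤ 1 / 8) :
    ‖eulerFactor' p z z' - ((1 - (p : ℂ)⁻¹) ^ m)‖ ≤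
      ((1 + 144 * δ * Real.log p / p) ^ m - 1) * (1 - (p : ℝ)⁻¹) ^ m := by
  rcases Nat.eq_zero_or_pos m with hm | hm
  · subst hm; simp [eulerFactor']
  have hpr : (0 : ℝ) < p := by exact_mod_cast (by omega : 0 < p)
  have hp2 : (2 : ℝ) ≤ p := by exact_mod_cast hp
  have hlog : 0 ≤ Real.log p := Real.log_nonneg (by linarith)
  have hδ0 : 0 ≤ δ := (norm_nonneg _).trans (hz ⟨0, hm⟩)
  set qC : ℂ := (p : ℂ)⁻¹ with hqC
  set q : ℝ := (p : ℝ)⁻¹ with hq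
  have hqn : ‖qC‖ = q := by simp [hqC, hq]
  have hq1 : q ≤ 1 / 2 := by rw [hq, inv_eq_one_div, div_le_div_iff₀ hpr (by norm_num)]; linarith
  have hq0 : 0 < q := by positivity
  -- the factors
  set a : Fin m → ℂ := fun j => (p : ℂ) ^ (-(1 + z j))
  set b : Fin m → ℂ := fun j => (p : ℂ) ^ (-(1 + z' j))
  set c : Fin m → ℂ := fun j => (p : ℂ) ^ (-(1 + z j + z' j))
  have hρ : ∀ j, ‖a j - qC‖ ≤ 2 / p * (δ * Real.log p) ∧ ‖b j - qC‖ ≤ 2 / p * (δ * Real.log p) ∧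
      ‖c j - qC‖ ≤ 2 / p * (2 * δ * Real.log p) := by
    intro j
    have hw1 : ‖z j‖ * Real.log p ≤ 1 := by nlinarith [hz j, norm_nonneg (z j)]
    have hw2 : ‖z' j‖ * Real.log p ≤ 1 := by nlinarith [hz' j, norm_nonneg (z' j)]
    have hw3 : ‖z j + z' j‖ * Real.log p ≤ 1 := by
      have : ‖z j + z' j‖ ≤ 2 * δ := (norm_add_le _ _).trans (by linarith [hz j, hz' j])
      nlinarith [norm_nonneg (z j + z' j)]
    refine ⟨(norm_cpow_neg_one_add_sub_inv_le hp hw1).trans (by gcongr; exact hz j),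
      (norm_cpow_neg_one_add_sub_inv_le hp hw2).trans (by gcongr; exact hz' j), ?_⟩
    have h := norm_cpow_neg_one_add_sub_inv_le hp hw3
    simp only [c, add_assoc]
    refine h.trans ?_
    have hzz : ‖z j + z' j‖ ≤ 2 * δ := (norm_add_le _ _).trans (by linarith [hz j, hz' j])
    have : ‖z j + z' j‖ * Real.log p ≤ 2 * δ * Real.log p := by nlinarith
    gcongr
  -- each factor is `(1 - q)(1 + v_j)` with `|v_j| ≤ 120 δ log p / p`
  set V : ℝ := 144 * δ * Real.log p / p with hV
  have hfac : ∀ j, ‖(1 - a j) * (1 - b j) / (1 - c j) / (1 - qC) - 1‖ ≤ V := by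
    intro j
    obtain ⟨ha, hb, hc⟩ := hρ j
    have hcn : ‖c j‖ ≤ 3 / 4 := by
      calc ‖c j‖ = ‖(c j - qC) + qC‖ := by rw [sub_add_cancel]
        _ ≤ ‖c j - qC‖ + ‖qC‖ := norm_add_le _ _
        _ ≤ 2 / p * (2 * δ * Real.log p) + q := by rw [hqn]; gcongr
        _ ≤ 1 * (1 / 8) + 1 / 2 := by
            gcongr
            · rw [div_le_iff₀ hpr]; linarith
        _ ≤ 3 / 4 := by norm_num
    have h := norm_factor_sub_one_sub_le qC (a j) (b j) (c j) hcn (by rw [hqn]; linarith)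
    have h1q : (1 : ℝ) / 2 ≤ ‖1 - qC‖ := by
      have := norm_sub_norm_le (1 : ℂ) qC; rw [norm_one, hqn] at this; linarith
    have h1q0 : (1 - qC) ≠ 0 := fun h0 => by rw [h0, norm_zero] at h1q; linarith
    rw [div_sub_one h1q0, norm_div, div_le_iff₀ (by linarith)]
    refine h.trans ?_
    have hρ0 : 2 / (p : ℝ) * (δ * Real.log p) ≤ 1 := by
      rw [div_mul_eq_mul_div, div_le_iff₀ hpr]; nlinarith
    have hprod : ‖a j - qC‖ * ‖b j - qC‖ ≤ 2 / p * (δ * Real.log p) * 1 :=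
      mul_le_mul ha (hb.trans hρ0) (norm_nonneg _) (by positivity)
    calc 4 * (2 * (‖a j - qC‖ + ‖b j - qC‖ + ‖c j - qC‖) + ‖a j - qC‖ * ‖b j - qC‖)
        ≤ 4 * (2 * (2 / p * (δ * Real.log p) + 2 / p * (δ * Real.log p) + 2 / p * (2 * δ * Real.log p)) +
            2 / p * (δ * Real.log p) * 1) := by
          have := add_le_add (add_le_add ha hb) hc
          nlinarith
      _ = (72 * δ * Real.log p / p) := by ring
      _ = V * (1 / 2) := by rw [hV]; ring
      _ ≤ V * ‖1 - qC‖ := by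
          have hV0 : 0 ≤ V := by rw [hV]; positivity
          nlinarith
  -- assemble: `E'_p = (1 - q)^m ∏ (1 + v_j)`
  set v : Fin m → ℂ := fun j => (1 - a j) * (1 - b j) / (1 - c j) / (1 - qC) - 1 with hv
  have h1q0 : (1 - qC) ≠ 0 := by
    intro h0
    have : ‖(1 : ℂ) - qC‖ = 0 := by rw [h0, norm_zero]
    have h' := norm_sub_norm_le (1 : ℂ) qC
    rw [norm_one, hqn] at h'
    linarith
  have hE : eulerFactor' p z z' = (1 - qC) ^ m * ∏ j, (1 + v j) := by
    unfold eulerFactor'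
    rw [← Fin.prod_const m (1 - qC), ← prod_mul_distrib]
    refine Fintype.prod_congr _ _ fun j => ?_
    simp only [hv, a, b, c]
    rw [add_sub_cancel, mul_div_cancel₀ _ h1q0]
  have hexp := norm_prod_one_add_sub_one_le univ v (G := V) fun j _ => hfac j
  rw [card_univ, Fintype.card_fin] at hexp
  rw [hE, ← mul_sub_one, norm_mul, norm_pow, mul_comm]
  have hnq : ‖1 - qC‖ = 1 - q := by
    rw [hqC, hq, ← Complex.ofReal_natCast, ← Complex.ofReal_inv, ← Complex.ofReal_one,
      ← Complex.ofReal_sub, Complex.norm_real, Real.norm_eq_abs, abs_of_nonneg (by linarith)]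
  rw [hnq]
  gcongr
  · exact pow_nonneg (by linarith) _

end SmallPrimes


section SmallPrimesProduct

open EulerPrime

/-- **`∏_{p ∈ S} E'_p = (1 + O(U))^{#S} ∏_{p ∈ S} (1 - 1/p)^m`** over a set `S` of small primes
(CFZ (36): `∏_{p ≤ w} E'_p = (1 + O(·)) (φ(W)/W)^m`): if `(1 + 144 δ log p/p)^m - 1 ≤ U` and
`2δ log p ≤ 1/8` for `p ∈ S`, then
`‖∏_{p∈S} E'_p - ∏_{p∈S} (1-1/p)^m‖ ≤ ((1+U)^{#S} - 1) ∏_{p∈S} (1-1/p)^m`.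
[cite: ConlonFoxZhao2014, Section 9, equation (36)] -/
theorem norm_prod_eulerFactor'_sub_le (S : Finset ℕ) (hS : ∀ p ∈ S, 2 ≤ p) {z z' : Fin m → ℂ}
    {δ U : ℝ} (hz : ∀ j, ‖z j‖ ≤ δ) (hz' : ∀ j, ‖z' j‖ ≤ δ)
    (hδ : ∀ p ∈ S, 2 * δ * Real.log p ≤ 1 / 8)
    (hU : ∀ p ∈ S, (1 + 144 * δ * Real.log p / p) ^ m - 1 ≤ U) :
    ‖(∏ p ∈ S, eulerFactor' p z z') - ∏ p ∈ S, ((1 - (p : ℂ)⁻¹) ^ m)‖ ≤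
      ((1 + U) ^ #S - 1) * ∏ p ∈ S, (1 - (p : ℝ)⁻¹) ^ m := by
  classical
  -- `G_p^m` as a complex number and its norm
  have hG : ∀ p ∈ S, ‖((1 - (p : ℂ)⁻¹) ^ m)‖ = (1 - (p : ℝ)⁻¹) ^ m ∧ (0 : ℝ) < (1 - (p : ℝ)⁻¹) ^ m := by
    intro p hp
    have hp2 : (2 : ℝ) ≤ p := by exact_mod_cast hS p hp
    have hq : (p : ℝ)⁻¹ ≤ 1 / 2 := by rw [inv_eq_one_div, div_le_div_iff₀ (by linarith) (by norm_num)]; linarith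
    have h1 : (0 : ℝ) < 1 - (p : ℝ)⁻¹ := by linarith
    refine ⟨?_, pow_pos h1 m⟩
    rw [norm_pow, ← Complex.ofReal_natCast, ← Complex.ofReal_inv, ← Complex.ofReal_one, ← Complex.ofReal_sub,
      Complex.norm_real, Real.norm_eq_abs, abs_of_pos h1]
  have hG0 : ∀ p ∈ S, ((1 - (p : ℂ)⁻¹) ^ m) ≠ 0 := fun p hp h0 => by
    have := (hG p hp).1; rw [h0, norm_zero] at this; linarith [(hG p hp).2]
  -- `E'_p = G_p^m (1 + u_p)` with `‖u_p‖ ≤ U`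
  set u : ℕ → ℂ := fun p => eulerFactor' p z z' / ((1 - (p : ℂ)⁻¹) ^ m) - 1 with hu
  have hE : ∀ p ∈ S, eulerFactor' p z z' = ((1 - (p : ℂ)⁻¹) ^ m) * (1 + u p) := fun p hp => by
    simp only [hu]; rw [add_sub_cancel, mul_div_cancel₀ _ (hG0 p hp)]
  have hun : ∀ p ∈ S, ‖u p‖ ≤ U := fun p hp => by
    have h := norm_eulerFactor'_sub_pow_le (hS p hp) hz hz' (hδ p hp)
    have hid : eulerFactor' p z z' - (1 - (p : ℂ)⁻¹) ^ m = ((1 - (p : ℂ)⁻¹) ^ m) * u p := by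
      simp only [hu]; rw [mul_sub, mul_one, mul_div_cancel₀ _ (hG0 p hp)]
    rw [hid, norm_mul, (hG p hp).1, mul_comm] at h
    exact (le_of_mul_le_mul_right h (hG p hp).2).trans (hU p hp)
  rw [prod_congr rfl hE, prod_mul_distrib, ← mul_sub_one, norm_mul, mul_comm]
  have hnorm : ‖∏ p ∈ S, ((1 - (p : ℂ)⁻¹) ^ m)‖ = ∏ p ∈ S, (1 - (p : ℝ)⁻¹) ^ m := by
    rw [norm_prod]; exact prod_congr rfl fun p hp => (hG p hp).1
  rw [hnorm]
  gcongr
  · exact prod_nonneg fun p hp => (hG p hp).2.le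
  · exact norm_prod_one_add_sub_one_le S u hun

end SmallPrimesProduct

end Literature.NumberTheory.Sieve.CFZ
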